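import Mathlib
import Summits.ResolutionOfSingularities.ResolutionOfSingularities.Theorems.RadicialJungCleanModelsCleanPermissibleSeq
import Literature.AlgebraicGeometry.Resolution.PrincipalizationOfProp44
import HarnessLib

/-!
# Route `RadicialJung`, crux `CleanModels` (stmt-ResolutionOfSingularities-15917), line `Sketch` rev 18, stub 4e
# `stub_cleanPrincipalization3`: CLEAN principalization from CLEAN embedded resolution of idealistic exponents
# (the clean twin of [CoP1] Prop. 4.2 ⇐ Prop. 4.4, `PrincipalizationOfProp44.lean`)

Second cut of the research residue X_perm of 4e («clean-permissible Cossart–Piltant principalization», hypothesis `hX` of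
✓ `stub_cleanPrincipalization3_of_cleanPermissiblePrincipalization`, `RadicialJungCleanModelsCleanPermissibleSeq.lean`) along the tree's
PROVED reduction of Cossart–Piltant 2008 Prop. 4.2 to Prop. 4.4 (`exists_principalization_of_prop44`: divisorial decomposition
`I = H·J`, bound on the order, induction on the maximal order `μ`, weak transforms `IsPermissibleSeq` / `controlledTransform`):

* `IsCleanPermissibleSeq p π J μ J' G` (inductive) — a permissible sequence for the idealistic exponent `(J, μ)` (`IsPermissibleSeq`:
  blowing ups along regular integral centres inside `{ord = μ}` of the successive weak transforms, `J'` the final weak transform) on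
  integral schemes with dominant steps, ALL OF WHOSE CENTRES ARE CLEAN-PERMISSIBLE (`CleanPermissibleAt`) for the current transform of `G`.
* `IsCleanPermissibleSeq.isPermissibleSeq` (forget), `IsCleanRegularCentreBlowupSeq.of_eq` (transport along an equality of morphisms).
* `IsCleanPermissibleSeq.transport` — the clean twin of `IsPermissibleSeq.transport`: along a clean-permissible sequence starting from a stage
  `ρ : X → S` of a CLEAN Cossart–Piltant sequence for `I` with `I𝒪_X = H·J` (`H` invertible, `V(J)` of codimension `≥ 2`), the composite is
  again a clean Cossart–Piltant stage with the same bookkeeping.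
* `cleanPermissiblePrincipalization_of_cleanProp44` — **X_perm ⟸ X44c**: if on every clean stage over `S` every idealistic exponent
  `(J, μ)` (`μ ≥ 1` the maximal order, `V(J)` of codimension `≥ 2`) is desingularized (`ord < μ` everywhere) by a CLEAN-permissible sequence,
  then `I` admits a clean-permissible principalization (`IsCleanRegularCentreBlowupSeq` + `IsLocallyPrincipal`).  With
  `stub_cleanPrincipalization3_of_cleanPermissiblePrincipalization` this places the research residue of 4e exactly parallel to the tree's
  `CossartPiltant2008_prop44` (proved by reach-tidy + slices + patching, `CP2008Prop44.cossartPiltant2008_prop44_holds`): X44c = the same with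
  clean-permissible centres — free at point centres (✓ `cleanPermissible_of_cleanRegAt`), open for the curve slice and reach-tidy step 3
  (memo `Cruxes/CleanModels/Lines/Sketch-memo-4e-cleanPermissible.md`).

Honest framing: OURS; X44c is NOT in print and NOT proved here; nothing here proves resolution in characteristic `p` or any case of `CleanModels`.
-/

noncomputable section

set_option linter.dupNamespace false -- mandated namespace of this single-conjunct summit

open IsLocalRing CategoryTheory CategoryTheory.Limits AlgebraicGeometry TopologicalSpace
open Literature.AlgebraicGeometry.Resolution Literature.AlgebraicGeometry.Motives
open Scheme.IdealSheafData

namespace Summit.ResolutionOfSingularities.ResolutionOfSingularities.Theorems.RadicialJung.CleanModels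

/-! ## Clean-permissible sequences for an idealistic exponent -/

/-- **Clean-permissible sequences for the idealistic exponent `(J, μ)`**: `IsCleanPermissibleSeq p π J μ J' G` says that `π : X' → X` is a
finite composition of blowing ups of integral schemes (dominant steps), each along a regular integral closed subscheme `Y` contained in the
locus `{ord = μ}` of the current weak transform (as in `IsPermissibleSeq`), each CLEAN-PERMISSIBLE at every point of `Y` for the current
transform of `G` (`CleanPermissibleAt … (RatFn.functionFieldMap π G) (𝓘_Y)_y`), and that `J'` is the resulting weak transform
(`controlledTransform`, iterated). [cite: CossartPiltant2008, proof of Prop. 4.2] [cite: Piltant2013, §2 Axiom 4] -/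
inductive IsCleanPermissibleSeq (p : ℕ) :
    ∀ {X' X : Scheme.{0}} [IsIntegral X'] [IsIntegral X] (π : X' ⟶ X) [IsDominant π],
      X.IdealSheafData → ℕ → X'.IdealSheafData → X.functionField → Prop
  /-- the empty sequence -/
  | nil {X : Scheme.{0}} [IsIntegral X] (J : X.IdealSheafData) (μ : ℕ) (G : X.functionField) :
      IsCleanPermissibleSeq p (𝟙 X) J μ J G
  /-- one more blowing up along a regular integral centre inside `{ord = μ}`, clean-permissible at each of its points -/
  | cons {X'' X' X : Scheme.{0}} [IsIntegral X''] [IsIntegral X'] [IsIntegral X] (τ : X'' ⟶ X') [IsDominant τ] (π : X' ⟶ X)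
      [IsDominant π] (J : X.IdealSheafData) (μ : ℕ) (J' : X'.IdealSheafData) (G : X.functionField) (Y : Closeds X') :
      IsCleanPermissibleSeq p π J μ J' G →
      IsIntegral (vanishingIdeal Y).subscheme →
      Scheme.IsRegular (vanishingIdeal Y).subscheme →
      (∀ y ∈ (Y : Set X'), idealOrder J' y = μ) →
      IsBlowup τ (vanishingIdeal Y) →
      (∀ y ∈ (Y : Set X'), CleanPermissibleAt p (algebraMap (X'.presheaf.stalk y) X'.functionField)
        (RatFn.functionFieldMap π G) (stalkIdeal (vanishingIdeal Y) y)) →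
      IsCleanPermissibleSeq p (τ ≫ π) J μ (controlledTransform τ (vanishingIdeal Y) J' μ) G

/-- Forgetting clean-permissibility. [folklore] -/
theorem IsCleanPermissibleSeq.isPermissibleSeq {p : ℕ} {X' X : Scheme.{0}} [IsIntegral X'] [IsIntegral X] {π : X' ⟶ X}
    [IsDominant π] {J : X.IdealSheafData} {μ : ℕ} {J' : X'.IdealSheafData} {G : X.functionField}
    (h : IsCleanPermissibleSeq p π J μ J' G) : IsPermissibleSeq π J μ J' := by
  induction h with
  | nil J μ G => exact IsPermissibleSeq.nil J μ
  | cons τ π J μ J' G Y _ hint hreg hY hτ _ ih => exact IsPermissibleSeq.cons τ π J μ J' Y ih hint hreg hY hτ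

/-- Transport of `IsCleanRegularCentreBlowupSeq` along an equality of the structure morphism (the dominance instances are propositions).
[folklore] -/
theorem IsCleanRegularCentreBlowupSeq.of_eq {p : ℕ} {S' S : Scheme.{0}} [IsIntegral S'] [IsIntegral S] {σ σ' : S' ⟶ S}
    [IsDominant σ] [IsDominant σ'] (e : σ = σ') {I : S.IdealSheafData} {G : S.functionField}
    (h : IsCleanRegularCentreBlowupSeq p σ I G) : IsCleanRegularCentreBlowupSeq p σ' I G := by
  subst e
  exact h

/-! ## Transport of the clean Cossart–Piltant bookkeeping along a clean-permissible sequence -/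

/-- **The clean twin of `IsPermissibleSeq.transport`.**  Let `S` be regular integral Noetherian, `I` an ideal sheaf and `G₀ ∈ K(S)`;
let `ρ : X → S` be a stage of a CLEAN Cossart–Piltant sequence for `I` and `G₀` (`IsCleanRegularCentreBlowupSeq`) with `X` Noetherian,
`I𝒪_X = H·J`, `H` effective Cartier, `V(J)` of codimension `≥ 2`, and `π : X' → X` a clean-permissible sequence for `(J, μ)`, `μ ≥ 1`,
and the transform `ρ^♯ G₀`, with weak transform `J'`.  Then `X'` is Noetherian, `π ≫ ρ` is again a clean Cossart–Piltant stage for `I`, `G₀`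
(the centres lie in the non-locally-principal loci and are clean-permissible for the right transform of `G₀`, `RatFn.functionFieldMap_comp`),
and `I𝒪_{X'} = H'·J'` with `H'` effective Cartier and `V(J')` of codimension `≥ 2`. [cite: CossartPiltant2008, proof of Prop. 4.2] -/
theorem IsCleanPermissibleSeq.transport {p : ℕ} {S : Scheme.{0}} [IsIntegral S] [IsNoetherian S]
    (hS : Scheme.IsRegular S) (I : S.IdealSheafData) (G₀ : S.functionField) :
    ∀ {X' X : Scheme.{0}} [IsIntegral X'] [IsIntegral X] {π : X' ⟶ X} [IsDominant π] {J : X.IdealSheafData} {μ : ℕ}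
      {J' : X'.IdealSheafData} {G : X.functionField},
      IsCleanPermissibleSeq p π J μ J' G → 1 ≤ μ →
      ∀ (ρ : X ⟶ S) [IsDominant ρ] (H : X.IdealSheafData), G = RatFn.functionFieldMap ρ G₀ → IsNoetherian X →
        IsCleanRegularCentreBlowupSeq p ρ I G₀ → IsEffectiveCartier H → I.comap ρ = H * J →
        (∀ x ∈ J.support, 1 < Order.coheight x) →
        IsNoetherian X' ∧ IsCleanRegularCentreBlowupSeq p (π ≫ ρ) I G₀ ∧
          ∃ H' : X'.IdealSheafData, IsEffectiveCartier H' ∧ I.comap (π ≫ ρ) = H' * J' ∧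
            ∀ x ∈ J'.support, 1 < Order.coheight x := by
  intro X' X _ _ π _ J μ J' G h
  induction h with
  | nil J μ G =>
    intro _ ρ _ H _ hnoeth hρ hH hfac hJ
    exact ⟨hnoeth, IsCleanRegularCentreBlowupSeq.of_eq (Category.id_comp ρ).symm hρ, H, hH,
      by rwa [Category.id_comp], hJ⟩
  | @cons X'' X' X _ _ _ τ _ π _ J μ J' G Y hπ hYint hYreg hY hτ hperm ih =>
    intro hμ ρ _ H hG hnoeth hρ hH hfac hJ
    obtain ⟨hnoeth', hρ', H', hH', hfac', hJ'⟩ := ih hμ ρ H hG hnoeth hρ hH hfac hJ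
    haveI := hnoeth'
    have hreg' := hρ'.isRegularCentreBlowupSeq.isRegular hS
    have hJ'0 : J' ≠ ⊥ := ne_bot_of_forall_one_lt_coheight hJ'
    -- the new scheme is Noetherian
    haveI : IsNoetherian X'' := by
      haveI : IsProper τ := hτ.isProper
      haveI := LocallyOfFiniteType.isLocallyNoetherian τ
      haveI := QuasiCompact.compactSpace_of_compactSpace τ
      exact {}
    refine ⟨inferInstance, ?_, H'.comap τ * (vanishingIdeal Y).comap τ ^ μ,
      (hH'.comap_of_isBlowup hτ).mul (hτ.isEffectiveCartier.pow μ), ?_, fun x hx =>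
      hτ.one_lt_coheight_of_mem_support_controlledTransform hreg' hYreg hY hJ' hx⟩
    · -- the centre lies in the non-locally-principal locus of `I𝒪 = H' · J'` and is clean-permissible for `(π ≫ ρ)^♯ G₀ = π^♯ G`
      refine IsCleanRegularCentreBlowupSeq.of_eq (Category.assoc τ π ρ).symm ?_
      refine IsCleanRegularCentreBlowupSeq.cons τ (π ≫ ρ) I G₀ Y hρ' hYint hYreg (fun y hy => ?_) hτ (fun y hy => ?_)
      · rw [hfac']
        refine not_isLocallyPrincipalAt_mul_of_forall_one_lt_coheight hH' hJ'0 hJ' ?_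
        refine (one_le_idealOrder_iff J' y).mp ?_
        rw [hY y hy]
        exact_mod_cast hμ
      · rw [RatFn.functionFieldMap_comp, RingHom.comp_apply, ← hG]
        exact hperm y hy
    · -- `I𝒪_{X''} = (H'𝒪 · 𝓘_E^μ) · J''`
      rw [Category.assoc, Scheme.IdealSheafData.comap_comp, hfac', comap_mul,
        ← hτ.pow_mul_controlledTransform_eq_of_forall_idealOrder_eq hreg' hYreg hY, mul_assoc]

/-! ## Clean Prop. 4.2 from clean Prop. 4.4 -/

/-- **X_perm ⟸ X44c (the clean twin of `exists_principalization_of_prop44`).**  Let `S` be a regular excellent integral Noetherian scheme,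
`G₀ ∈ K(S)` with clean-regular line at every point, `I ≠ 0` an ideal sheaf.  Suppose CLEAN Prop. 4.4 on the clean stages over `S`: for every
stage `ρ : X → S` of a clean Cossart–Piltant sequence for `I`, `G₀` (`X` integral Noetherian; the line of `ρ^♯ G₀` is then clean-regular
everywhere, which is handed over) and every idealistic exponent `(J, μ)` on `X` with `μ ≥ 1` the maximal order of `J` and `V(J)` of
codimension `≥ 2`, there is a CLEAN-permissible sequence `π : X' → X` whose weak transform has order `< μ` everywhere.  Then `I` admits a
clean-permissible principalization. Proof as printed for [CoP1] Prop. 4.2: `I = H·J` (`exists_divisorial_decomposition`), bound on the order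
(`exists_forall_idealOrder_lt`), induction on the bound with `IsCleanPermissibleSeq.transport`. [cite: CossartPiltant2008, Prop. 4.2 (proof)] -/
theorem cleanPermissiblePrincipalization_of_cleanProp44 {p : ℕ} (hp : p.Prime) (S : Scheme.{0}) [IsIntegral S] [IsNoetherian S]
    (hchar : CharP S.functionField p) (hreg : Scheme.IsRegular S) (hexc : Scheme.IsExcellent S) (G₀ : S.functionField)
    (hG₀ : ∀ s : S, CleanRegAt p (algebraMap (S.presheaf.stalk s) S.functionField) G₀) (I : S.IdealSheafData) (hI : I ≠ ⊥)
    (h44c : ∀ (X : Scheme.{0}) (ρ : X ⟶ S) [IsIntegral X] [IsNoetherian X] [IsDominant ρ],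
      IsCleanRegularCentreBlowupSeq p ρ I G₀ →
      (∀ x : X, CleanRegAt p (algebraMap (X.presheaf.stalk x) X.functionField) (RatFn.functionFieldMap ρ G₀)) →
      ∀ (J : X.IdealSheafData) (μ : ℕ), 1 ≤ μ →
        (∀ x ∈ J.support, 1 < Order.coheight x) → (∀ x, idealOrder J x ≤ μ) → (∃ x, idealOrder J x = μ) →
        ∃ (X' : Scheme.{0}) (π : X' ⟶ X) (_ : IsIntegral X') (_ : IsDominant π) (J' : X'.IdealSheafData),
          IsCleanPermissibleSeq p π J μ J' (RatFn.functionFieldMap ρ G₀) ∧ ∀ x, idealOrder J' x < μ) :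
    ∃ (S' : Scheme.{0}) (σ : S' ⟶ S) (_ : IsIntegral S') (_ : IsDominant σ),
      IsCleanRegularCentreBlowupSeq p σ I G₀ ∧ IsLocallyPrincipal (I.comap σ) := by
  -- the claim, by induction on a bound `m` for the order of `J`
  have claim : ∀ (m : ℕ) (X : Scheme.{0}) (ρ : X ⟶ S) (H J : X.IdealSheafData)
      [IsIntegral X] [IsNoetherian X] [IsDominant ρ], IsCleanRegularCentreBlowupSeq p ρ I G₀ → IsEffectiveCartier H →
      I.comap ρ = H * J → (∀ x ∈ J.support, 1 < Order.coheight x) →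
      (∀ x, idealOrder J x ≤ m) →
      ∃ (S' : Scheme.{0}) (σ : S' ⟶ S) (_ : IsIntegral S') (_ : IsDominant σ),
        IsCleanRegularCentreBlowupSeq p σ I G₀ ∧ IsLocallyPrincipal (I.comap σ) := by
    intro m
    induction m with
    | zero =>
      intro X ρ H J _ _ _ hρ hH hfac hJ hbd
      -- `ord J ≤ 0` everywhere: `J = 𝒪_X` and `I𝒪_X = H` is invertible
      have hJtop : J = ⊤ := by
        rw [← support_eq_bot_iff, eq_bot_iff]
        intro x hx
        have h1 := (one_le_idealOrder_iff J x).mpr hx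
        have h2 := h1.trans (hbd x)
        norm_num at h2
      refine ⟨X, ρ, inferInstance, inferInstance, hρ, ?_⟩
      rw [hfac, hJtop, ← Scheme.IdealSheafData.one_eq_top, mul_one]
      exact hH.isLocallyPrincipal
    | succ m ih =>
      intro X ρ H J _ _ _ hρ hH hfac hJ hbd
      by_cases hall : ∀ x, idealOrder J x ≤ m
      · exact ih X ρ H J hρ hH hfac hJ hall
      push Not at hall
      obtain ⟨x₀, hx₀⟩ := hall
      have hx₀' : idealOrder J x₀ = (m + 1 : ℕ) := by
        refine le_antisymm (hbd x₀) ?_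
        have := Order.add_one_le_of_lt hx₀
        exact_mod_cast this
      -- clean Prop. 4.4 for `(J, m + 1)` on the clean stage `X`
      obtain ⟨X', π, hX', hπd, J', hπ, hJ'⟩ :=
        h44c X ρ hρ (hρ.cleanRegAt hp hchar hG₀) J (m + 1) m.succ_pos hJ hbd ⟨x₀, hx₀'⟩
      haveI := hX'
      haveI := hπd
      obtain ⟨hnoeth', hρ', H', hH', hfac', hJ'coh⟩ :=
        hπ.transport hreg I G₀ m.succ_pos ρ H rfl inferInstance hρ hH hfac hJ
      haveI := hnoeth'
      refine ih X' (π ≫ ρ) H' J' hρ' hH' hfac' hJ'coh fun x => ?_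
      have := hJ' x
      push_cast at this
      exact Order.le_of_lt_add_one this
  -- start: `I = H · J` on `S` and a bound for the order of `J`
  obtain ⟨H, J, hH, hHJ, -, -, hJcoh⟩ := exists_divisorial_decomposition hreg hI
  have hJ0 : J ≠ ⊥ := ne_bot_of_forall_one_lt_coheight hJcoh
  obtain ⟨N, hN⟩ := exists_forall_idealOrder_lt hreg hexc hJ0
  exact claim N S (𝟙 S) H J (IsCleanRegularCentreBlowupSeq.nil I G₀) hH
    (by rw [Scheme.IdealSheafData.comap_id, hHJ]) hJcoh fun x => (hN x).le

/-- **The research residue of 4e, second cut (X44c ⟹ X_perm in the shape consumed by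
`stub_cleanPrincipalization3_of_cleanPermissiblePrincipalization`).**  CLEAN [CoP1] Prop. 4.4 on clean stages over regular excellent
threefolds ⟹ clean-permissible principalization. [cite: CossartPiltant2008, Prop. 4.2 (proof), Prop. 4.4] -/
theorem cleanPermissiblePrincipalization3_of_cleanProp44
    (h44c : ∀ (p : ℕ), p.Prime → ∀ (S : Scheme.{0}) [IsIntegral S] [IsNoetherian S],
      CharP S.functionField p → Scheme.IsRegular S → Scheme.IsExcellent S → topologicalKrullDim S = 3 →
      ∀ G₀ : S.functionField, (∀ s : S, CleanRegAt p (algebraMap (S.presheaf.stalk s) S.functionField) G₀) →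
      ∀ I : S.IdealSheafData, I ≠ ⊥ →
      ∀ (X : Scheme.{0}) (ρ : X ⟶ S) [IsIntegral X] [IsNoetherian X] [IsDominant ρ],
        IsCleanRegularCentreBlowupSeq p ρ I G₀ →
        (∀ x : X, CleanRegAt p (algebraMap (X.presheaf.stalk x) X.functionField) (RatFn.functionFieldMap ρ G₀)) →
        ∀ (J : X.IdealSheafData) (μ : ℕ), 1 ≤ μ →
          (∀ x ∈ J.support, 1 < Order.coheight x) → (∀ x, idealOrder J x ≤ μ) → (∃ x, idealOrder J x = μ) →
          ∃ (X' : Scheme.{0}) (π : X' ⟶ X) (_ : IsIntegral X') (_ : IsDominant π) (J' : X'.IdealSheafData),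
            IsCleanPermissibleSeq p π J μ J' (RatFn.functionFieldMap ρ G₀) ∧ ∀ x, idealOrder J' x < μ) :
    ∀ (p : ℕ), p.Prime → ∀ (S : Scheme.{0}) [IsIntegral S] [IsNoetherian S],
      CharP S.functionField p → Scheme.IsRegular S → Scheme.IsExcellent S → topologicalKrullDim S = 3 →
      ∀ G : S.functionField, (∀ s : S, CleanRegAt p (algebraMap (S.presheaf.stalk s) S.functionField) G) →
      ∀ J : S.IdealSheafData, J ≠ ⊥ →
        ∃ (S' : Scheme.{0}) (σ : S' ⟶ S) (_ : IsIntegral S') (_ : IsDominant σ),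
          IsCleanRegularCentreBlowupSeq p σ J G ∧ IsLocallyPrincipal (J.comap σ) :=
  fun p hp S _ _ hchar hreg hexc hdim G hG J hJ =>
    cleanPermissiblePrincipalization_of_cleanProp44 hp S hchar hreg hexc G hG J hJ (h44c p hp S hchar hreg hexc hdim G hG J hJ)

end Summit.ResolutionOfSingularities.ResolutionOfSingularities.Theorems.RadicialJung.CleanModels

end
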